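import Summits.QuantumFields.YangMills.Theses.SqueezedSkewness

/-!
# Birth skeleton (BC3-style plan) for the SUPPORT item `SqueezedSkewness.DivisibleBump` (stmt-QuantumFields-28193)

Planner ym-idea-6 g7, LINE A «vacuum domination» (route `SqueezedSkewness` rev 7; item shared with `ThermalDescent`'s split of
`ZeroTemperatureFloors`).  Four registered stubs and the kernel-checked composition
`DivisibleBump_of : BumpData → PoissonDomination → LaplaceDomination → TensorDomination → SqueezedSkewness.DivisibleBump`.

* `stub_bumpData` (M, construction): for `0 < ρ' ≤ 1/4` the 1-D profiles `φv, φf, ψv, ψf` and their tensor products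
  `V = φv ⊗ ψv^{⊗3}`, `F = φf ⊗ ψf^{⊗3}` as Schwartz maps, with signs, supports (time slab of `V` in `(1-ρ'/2, 2)`, `V ⊆ closedBall(e₀, ρ')`,
  `F ⊆ closedBall(2e₀, 1/2)`) and the Fourier-side facts `𝓕ψv` real `≥ 0`, `|𝓕ψf| ≤ 𝓕ψv`.  Intended: `ψv = b ⋆ b̃` (`b ≥ 0` smooth,
  radius `ρ'/4`), `ψf = ψv ⋆ K` (`K ≥ 0` smooth even, radius `1/16`, `∫K = 1`), `φv ⊂ (1-ρ'/4, 1+ρ'/4)`, `φf ⊂ (15/8, 17/8)`;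
  the box of half-widths `(1/8; 3/16, 3/16, 3/16)` fits the ball: `1/64 + 27/256 < 1/4`.
* `stub_poissonDomination` (M, the 1-D core): `𝓕ψ` real `≥ 0` and `|𝓕g| ≤ 𝓕ψ` ⇒ `|Σ_n g(sn) e^{isθn}| ≤ |Σ_n ψ(sn) e^{isθn}|` for EVERY `s > 0`
  — Poisson summation (`SchwartzMap.tsum_eq_tsum_fourierIntegral`): both sides are `s⁻¹ Σ_m 𝓕(·)(m/s − θ/2π)`, the right one termwise `≥ 0`.
* `stub_laplaceDomination` (M): lower slabs dominate higher slabs in the lattice Laplace sums for `s ≤ s₀` (Riemann sums).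
* `stub_tensorDomination` (M, bookkeeping): the `ℤ⁴` Laplace–Fourier sum of a tensor product factorises (Fubini for `tsum`), so the 1-D
  dominations multiply.
Nothing here proves `DivisibleBump`, NT or the mass gap; `sorry` occurs exactly in the four stubs.  Prover pointers:
`Cruxes/NT/Lines/vacuum_domination_pointers.md` §4.
-/

set_option autoImplicit false

namespace Summit.QuantumFields.YangMills.Cruxes.NT.DivisibleBumpBirth

/-- 1-D lattice Laplace sum `Σ_n φ(sn) e^{-Esn}`. -/
noncomputable def LT (s : ℝ) (φ : SchwartzMap ℝ ℝ) (E : ℝ) : ℝ :=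
  ∑' n : ℤ, φ (s * n) * Real.exp (-(E * (s * n)))

/-- 1-D lattice Fourier sum `Σ_n ψ(sn) e^{i s θ n}`. -/
noncomputable def LS (s : ℝ) (ψ : SchwartzMap ℝ ℝ) (θ : ℝ) : ℂ :=
  ∑' n : ℤ, (ψ (s * n) : ℂ) * Complex.exp (Complex.I * ((s * (θ * n) : ℝ) : ℂ))

/-- Stub statement D (construction of the bump data). -/
def BumpData : Prop :=
  ∀ ρ' : ℝ, 0 < ρ' → ρ' ≤ 1 / 4 → ∃ (φv φf ψv ψf : SchwartzMap ℝ ℝ) (V F : SchwartzMap (EuclideanSpace ℝ (Fin 4)) ℝ), (∀ x, V x = φv (x 0) * ∏ k : Fin 3, ψv (x k.succ)) ∧ (∀ x, F x = φf (x 0) * ∏ k : Fin 3, ψf (x k.succ)) ∧ (∀ x, 0 ≤ V x) ∧ (∀ x, 0 ≤ F x) ∧ (∃ x, F x ≠ 0) ∧ (∃ t, φv t ≠ 0) ∧ (∀ t, 0 ≤ φv t) ∧ (∀ t, 0 ≤ φf t) ∧ tsupport (φv : ℝ → ℝ) ⊆ Set.Icc (1 - ρ' / 4) (1 + ρ' /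 4) ∧ tsupport (φf : ℝ → ℝ) ⊆ Set.Icc (15 / 8 : ℝ) (17 / 8) ∧ tsupport (V : EuclideanSpace ℝ (Fin 4) → ℝ) ⊆ Metric.closedBall (EuclideanSpace.single (0 : Fin 4) (1 : ℝ)) ρ' ∧ tsupport (V : EuclideanSpace ℝ (Fin 4) → ℝ) ⊆ {y : EuclideanSpace ℝ (Fin 4) | 1 - ρ' / 2 < y 0 ∧ y 0 < 2} ∧ tsupport (F : EuclideanSpace ℝ (Fin 4) → ℝ) ⊆ Metric.closedBall (EuclideanSpace.single (0 : Fin 4) (2 : ℝ)) (1 / 2 : ℝ) ∧ (∀ ξ : ℝ, (FourierTransform.fourier (fun x : ℝ => (ψv x : ℂ)) ξ).im = 0 ∧ 0 ≤ (FourierTransform.fourier (fun x : ℝ => (ψv x : ℂ)) ξ).re) ∧ (∀ ξ : ℝ, ‖FourierTransform.fourier (fun x : ℝ => (ψf x : ℂ)) ξ‖ ≤ (FourierTransform.fourier (fun x : ℝ => (ψv x : ℂ)) ξ).re)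

/-- Stub statement B (Poisson domination, the 1-D core). -/
def PoissonDomination : Prop :=
  ∀ (ψ g : SchwartzMap ℝ ℝ), (∀ ξ : ℝ, (FourierTransform.fourier (fun x : ℝ => (ψ x : ℂ)) ξ).im = 0 ∧ 0 ≤ (FourierTransform.fourier (fun x : ℝ => (ψ x : ℂ)) ξ).re) → (∀ ξ : ℝ, ‖FourierTransform.fourier (fun x : ℝ => (g x : ℂ)) ξ‖ ≤ (FourierTransform.fourier (fun x : ℝ => (ψ x : ℂ)) ξ).re) → ∀ s : ℝ, 0 < s → ∀ θ : ℝ, ‖LS s g θ‖ ≤ ‖LS s ψ θ‖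

/-- Stub statement C (Laplace domination of a higher slab by a lower slab, small spacing). -/
def LaplaceDomination : Prop :=
  ∀ (φv φf : SchwartzMap ℝ ℝ) (τ₁ τ₂ σ₁ σ₂ : ℝ), 0 < τ₁ → τ₂ ≤ σ₁ → (∀ t, 0 ≤ φv t) → (∀ t, 0 ≤ φf t) → tsupport (φv : ℝ → ℝ) ⊆ Set.Icc τ₁ τ₂ → tsupport (φf : ℝ → ℝ) ⊆ Set.Icc σ₁ σ₂ → (∃ t, φv t ≠ 0) → ∃ (c s₀ : ℝ), 0 < c ∧ 0 < s₀ ∧ ∀ s : ℝ, 0 < s → s ≤ s₀ → ∀ E : ℝ, 0 ≤ E → c * |LT s φf E| ≤ |LT s φv E|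

/-- Stub statement A (tensor factorisation ⇒ 4-D domination from 1-D dominations). -/
def TensorDomination : Prop :=
  let LF : ℝ → SchwartzMap (EuclideanSpace ℝ (Fin 4)) ℝ → ℝ → (Fin 3 → ℝ) → ℂ := fun s f E p => ∑' x : Fin 4 → ℤ, (((f (s • Literature.MathematicalPhysics.QuantumLattice.siteToE (d := 4) x) * Real.exp (-(E * (s * (x 0 : ℝ))))) : ℝ) : ℂ) * Complex.exp (Complex.I * ((s * ∑ k : Fin 3, p k * (x k.succ : ℝ) : ℝ) : ℂ)); ∀ s : ℝ, 0 < s → ∀ (φv φf ψv ψf : SchwartzMap ℝ ℝ) (V F : SchwartzMap (EuclideanSpace ℝ (Fin 4)) ℝ), (∀ x, V x = φv (x 0) * ∏ k : Fin 3, ψv (x k.succ)) → (∀ x, F x = φf (x 0) * ∏ k : Fin 3, ψf (x k.succ)) → ∀ ct : ℝ, 0 ≤ ct → (∀ E : ℝ, 0 ≤ E → ct * |LT s φf E| ≤ |LT s φv E|) → (∀ θ : ℝ, ‖LS s ψf θ‖ ≤ ‖LS s ψv θ‖) → ∀ E : ℝ, 0 ≤ E → ∀ p : Fin 3 → ℝ,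 ct * ‖LF s F E p‖ ≤ ‖LF s V E p‖

theorem stub_bumpData : BumpData := by
  sorry

theorem stub_poissonDomination : PoissonDomination := by
  sorry

theorem stub_laplaceDomination : LaplaceDomination := by
  sorry

theorem stub_tensorDomination : TensorDomination := by
  sorry

/-- Composition (kernel-checked, no sorry): the four stubs give the route item BY NAME. -/
theorem DivisibleBump_of (hD : BumpData) (hB : PoissonDomination) (hC : LaplaceDomination) (hA : TensorDomination) :
    Summit.QuantumFields.YangMills.Theses.SqueezedSkewness.DivisibleBump := by
  have hA' := hA
  dsimp only [TensorDomination, Summit.QuantumFields.YangMills.Theses.SqueezedSkewness.DivisibleBump] at hA' ⊢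
  intro ρ hρ
  set ρ' : ℝ := min ρ (1 / 4) with hρ'def
  have hρ'pos : 0 < ρ' := lt_min hρ (by norm_num)
  have hρ'le : ρ' ≤ 1 / 4 := min_le_right _ _
  have hρ'leρ : ρ' ≤ ρ := min_le_left _ _
  obtain ⟨φv, φf, ψv, ψf, V, F, hVx, hFx, hV0, hF0, ⟨x₁, hx₁⟩, hφvne, hφv0, hφf0, hφvsupp, hφfsupp, hVball, hVslab,
    hFball, hFTv, hFTf⟩ := hD ρ' hρ'pos hρ'le
  -- 1-D dominations
  have hLS : ∀ s : ℝ, 0 < s → ∀ θ : ℝ, ‖LS s ψf θ‖ ≤ ‖LS s ψv θ‖ := hB ψv ψf hFTv hFTf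
  obtain ⟨ct, s₀, hct, hs₀, hLT⟩ := hC φv φf (1 - ρ' / 4) (1 + ρ' / 4) (15 / 8) (17 / 8) (by linarith) (by linarith)
    hφv0 hφf0 hφvsupp hφfsupp hφvne
  refine ⟨V, F, hV0, hVball.trans (Metric.closedBall_subset_closedBall hρ'leρ), ⟨1 - ρ' / 2, 2, by linarith, hVslab⟩,
    hF0, ?_, hFball, ct, s₀, hct, hs₀, ?_⟩
  · intro hF
    exact hx₁ (by simp [hF])
  · intro s hs hss₀ E hE p
    exact hA' s hs φv φf ψv ψf V F hVx hFx ct hct.le (fun E' hE' => hLT s hs hss₀ E' hE') (hLS s hs) E hE p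

/-- The item from the registered stubs. -/
theorem DivisibleBump_holds_of_stubs : Summit.QuantumFields.YangMills.Theses.SqueezedSkewness.DivisibleBump :=
  DivisibleBump_of stub_bumpData stub_poissonDomination stub_laplaceDomination stub_tensorDomination

end Summit.QuantumFields.YangMills.Cruxes.NT.DivisibleBumpBirth
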